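import Literature.NumberTheory.LFunctions.RHWave0PNTProofs
import Literature.NumberTheory.LFunctions.LogIntegralProofs
import HarnessLib

/-!
# `θ(x)/π(x) = log x - 1 + o(1)` and the prime sums along the `n`-th prime

Topic `Literature/NumberTheory/LFunctions`. Everything in this file is PROVED (no named facts, no
definitions).

Consequences of the prime number theorem (`Literature.NumberTheory.LFunctions.chebyshevTheta_isEquivalent`,
`Literature.NumberTheory.LFunctions.primeCounting_isEquivalent_holds`) needed for the asymptotic
optimisation in C. Bright, *A new lower bound in the abc conjecture*, Canad. Math. Bull. 67 (2024),
§2.5 and §3.1 (there via the expansion of `li`, Lemmas 2.8–2.9; here only the leading terms are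
extracted):

* `isEquivalent_integral_theta_div` : `∫₂ˣ θ(t) dt/(t log² t) ∼ x / log² x` (from `θ(t) ∼ t`
  and `Li₂ x ∼ x/log² x`, `Literature.NumberTheory.LFunctions.isEquivalent_offsetLogIntegralPow_holds`);
* `tendsto_primeCounting_mul_log_sub_theta_div` : `(π(x) log x - θ(x)) / π(x) → 1`, i.e.
  `θ(x)/π(x) = log x - 1 + o(1)` (Abel summation, Mathlib's
  `Chebyshev.primeCounting_eq_theta_div_log_add_integral`);
* `tendsto_primeCounting_mul_log_div` : `π(x) log x / x → 1`;
* along the primes: `primeCounting_nth_prime` (`π(p_n) = n + 1` for the `n`-th prime `p_n`,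
  `p_0 = 2`), `theta_nth_prime` (`θ(p_n) = ∑_{k ≤ n} log p_k`), `tendsto_nth_prime_atTop`, and the
  two limits `tendsto_card_mul_log_nth_prime_div` (`(n+1) log p_n / p_n → 1`) and
  `tendsto_sum_log_nth_prime_div_sub_log` (`(∑_{1 ≤ k ≤ n} log p_k)/(n+1) - log p_n → -1`).

## References

* C. Bright, *A new lower bound in the abc conjecture*, Canad. Math. Bull. 67 (2024) 369–378,
  §2.5 (Lemmas 2.8, 2.9) and §3.1 [Bright2024].
* H. L. Montgomery, R. C. Vaughan, *Multiplicative Number Theory I*, CUP 2007, §8.1 [MontgomeryVaughan2007].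
-/

noncomputable section

open Filter Asymptotics Real MeasureTheory Set
open scoped Topology Chebyshev

namespace Literature.NumberTheory.LFunctions

/-! ### `∫₂ˣ θ(t)/(t log² t) dt ∼ x / log² x` -/

/-- The integrand `θ(t)/(t log² t)` is interval integrable on `[a, b] ⊆ [2, ∞)` (a private copy
of the identical helper in `MidpointSieveGain.lean`, not imported to keep this file light).
[folklore] -/
private theorem intervalIntegrable_theta_div_log_sq {a b : ℝ} (ha : 2 ≤ a) (hab : a ≤ b) :
    IntervalIntegrable (fun t ↦ θ t / (t * Real.log t ^ 2)) volume a b := by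
  rw [intervalIntegrable_iff_integrableOn_Icc_of_le hab]
  exact (Chebyshev.integrableOn_theta_div_id_mul_log_sq b).mono_set (Icc_subset_Icc_left ha)

/-- **`∫₂ˣ θ(t) dt/(t log² t) ∼ x/log² x`.** Since `θ(t) = t + o(t)` (prime number theorem) the
integral differs from `Li₂ x = ∫₂ˣ dt/log² t` by `o(Li₂ x)`, and `Li₂ x ∼ x/log² x`
(`isEquivalent_offsetLogIntegralPow_holds`). [cite: MontgomeryVaughan2007, §8.1] -/
theorem isEquivalent_integral_theta_div :
    (fun x ↦ ∫ t in (2 : ℝ)..x, θ t / (t * Real.log t ^ 2)) ~[atTop]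
      fun x ↦ x / Real.log x ^ 2 := by
  have hLi : offsetLogIntegralPow 2 ~[atTop] fun x ↦ x / Real.log x ^ 2 :=
    isEquivalent_offsetLogIntegralPow_holds 2
  refine IsEquivalent.trans ?_ hLi
  -- `∫ θ/(t log²t) - Li₂ = o(Li₂)`
  rw [IsEquivalent, isLittleO_iff]
  intro ε hε
  have hε2 : 0 < ε / 2 := by linarith
  -- `|θ t - t| ≤ (ε/2) t` for `t ≥ T`
  have hθ : ∀ᶠ t in atTop, |θ t - t| ≤ ε / 2 * t := by
    have h := (chebyshevTheta_isEquivalent.isLittleO.def hε2)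
    filter_upwards [h, eventually_ge_atTop 0] with t ht ht0
    simpa [Real.norm_eq_abs, abs_of_nonneg ht0] using ht
  obtain ⟨T₀, hT₀⟩ := eventually_atTop.mp hθ
  set T := max T₀ 2 with hT
  have hT2 : 2 ≤ T := le_max_right _ _
  -- the tail of `Li₂` dominates constants
  have hLi_top : Tendsto (offsetLogIntegralPow 2) atTop atTop := tendsto_offsetLogIntegralPow_atTop 2
  set C := |∫ t in (2 : ℝ)..T, (θ t / (t * Real.log t ^ 2) - (Real.log t)⁻¹ ^ 2)| with hC
  have hC_ev : ∀ᶠ x in atTop, C ≤ ε / 2 * offsetLogIntegralPow 2 x := by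
    have := hLi_top.eventually_ge_atTop (C / (ε / 2))
    filter_upwards [this] with x hx
    rwa [div_le_iff₀' hε2] at hx
  filter_upwards [hC_ev, eventually_ge_atTop T] with x hCx hTx
  have h2x : 2 ≤ x := hT2.trans hTx
  have h1x : 1 < x := by linarith
  -- rewrite the difference as one integral and split at `T`
  have hint1 : IntervalIntegrable (fun t ↦ θ t / (t * Real.log t ^ 2)) volume 2 x :=
    intervalIntegrable_theta_div_log_sq le_rfl h2x
  have hint2 : IntervalIntegrable (fun t : ℝ ↦ (Real.log t)⁻¹ ^ 2) volume 2 x :=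
    intervalIntegrable_inv_log_pow 2 one_lt_two h1x
  have hdiff : (∫ t in (2 : ℝ)..x, θ t / (t * Real.log t ^ 2)) - offsetLogIntegralPow 2 x
      = ∫ t in (2 : ℝ)..x, (θ t / (t * Real.log t ^ 2) - (Real.log t)⁻¹ ^ 2) := by
    rw [offsetLogIntegralPow, intervalIntegral.integral_sub hint1 hint2]
  have hintd : ∀ {a b : ℝ}, 2 ≤ a → a ≤ b →
      IntervalIntegrable (fun t ↦ θ t / (t * Real.log t ^ 2) - (Real.log t)⁻¹ ^ 2) volume a b := by
    intro a b ha hab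
    exact (intervalIntegrable_theta_div_log_sq ha hab).sub
      (intervalIntegrable_inv_log_pow 2 (by linarith) (by linarith))
  have hsplit : (∫ t in (2 : ℝ)..x, (θ t / (t * Real.log t ^ 2) - (Real.log t)⁻¹ ^ 2))
      = (∫ t in (2 : ℝ)..T, (θ t / (t * Real.log t ^ 2) - (Real.log t)⁻¹ ^ 2))
        + ∫ t in T..x, (θ t / (t * Real.log t ^ 2) - (Real.log t)⁻¹ ^ 2) :=
    (intervalIntegral.integral_add_adjacent_intervals (hintd le_rfl hT2) (hintd hT2 hTx)).symm
  -- the tail integral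
  have htail : |∫ t in T..x, (θ t / (t * Real.log t ^ 2) - (Real.log t)⁻¹ ^ 2)|
      ≤ ε / 2 * offsetLogIntegralPow 2 x := by
    have hb : |∫ t in T..x, (θ t / (t * Real.log t ^ 2) - (Real.log t)⁻¹ ^ 2)|
        ≤ ∫ t in T..x, ε / 2 * (Real.log t)⁻¹ ^ 2 := by
      rw [← Real.norm_eq_abs]
      refine intervalIntegral.norm_integral_le_of_norm_le hTx ?_ ?_
      · filter_upwards with t ht
        have hTt : T < t := ht.1
        have ht2 : 2 < t := lt_of_le_of_lt hT2 hTt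
        have ht0 : 0 < t := by linarith
        have hlog : 0 < Real.log t := Real.log_pos (by linarith)
        have hθt : |θ t - t| ≤ ε / 2 * t := hT₀ t ((le_max_left _ _).trans hTt.le)
        rw [Real.norm_eq_abs]
        have : θ t / (t * Real.log t ^ 2) - (Real.log t)⁻¹ ^ 2
            = (θ t - t) / (t * Real.log t ^ 2) := by
          field_simp
        rw [this, abs_div, abs_of_pos (by positivity : 0 < t * Real.log t ^ 2), div_le_iff₀
          (by positivity)]
        calc |θ t - t| ≤ ε / 2 * t := hθt
          _ = ε / 2 * (Real.log t)⁻¹ ^ 2 * (t * Real.log t ^ 2) := by field_simp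
      · exact ((intervalIntegrable_inv_log_pow 2 (by linarith) h1x).const_mul _)
    refine hb.trans ?_
    rw [intervalIntegral.integral_const_mul]
    refine mul_le_mul_of_nonneg_left ?_ hε2.le
    -- `∫_T^x ≤ ∫_2^x`
    have hadd : offsetLogIntegralPow 2 x = offsetLogIntegralPow 2 T
        + ∫ t in T..x, (Real.log t)⁻¹ ^ 2 := by
      rw [offsetLogIntegralPow, offsetLogIntegralPow]
      exact (intervalIntegral.integral_add_adjacent_intervals
        (intervalIntegrable_inv_log_pow 2 one_lt_two (by linarith))
        (intervalIntegrable_inv_log_pow 2 (by linarith) h1x)).symm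
    rw [hadd]
    linarith [offsetLogIntegralPow_nonneg 2 hT2]
  -- assemble
  have hLi0 : 0 ≤ offsetLogIntegralPow 2 x := offsetLogIntegralPow_nonneg 2 h2x
  simp only [Pi.sub_apply, Real.norm_eq_abs]
  rw [abs_of_nonneg hLi0, hdiff, hsplit]
  calc |(∫ t in (2 : ℝ)..T, (θ t / (t * Real.log t ^ 2) - (Real.log t)⁻¹ ^ 2))
          + ∫ t in T..x, (θ t / (t * Real.log t ^ 2) - (Real.log t)⁻¹ ^ 2)|
        ≤ C + |∫ t in T..x, (θ t / (t * Real.log t ^ 2) - (Real.log t)⁻¹ ^ 2)| :=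
          abs_add_le _ _
    _ ≤ ε / 2 * offsetLogIntegralPow 2 x + ε / 2 * offsetLogIntegralPow 2 x := add_le_add hCx htail
    _ = ε * offsetLogIntegralPow 2 x := by ring

/-! ### `θ(x)/π(x) = log x - 1 + o(1)` and `π(x) log x / x → 1` -/

/-- **`(π(x) log x - θ(x))/π(x) → 1`**, i.e. `θ(x) = π(x)(log x - 1 + o(1))`: by Abel summation
`π(x) log x - θ(x) = log x ∫₂ˣ θ(t) dt/(t log² t) ∼ x/log x ∼ π(x)`.
[cite: MontgomeryVaughan2007, §8.1] -/
theorem tendsto_primeCounting_mul_log_sub_theta_div :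
    Tendsto (fun x : ℝ ↦ ((Nat.primeCounting ⌊x⌋₊ : ℝ) * Real.log x - θ x)
      / (Nat.primeCounting ⌊x⌋₊ : ℝ)) atTop (𝓝 1) := by
  have hπ : (fun x : ℝ ↦ (Nat.primeCounting ⌊x⌋₊ : ℝ)) ~[atTop] fun x ↦ x / Real.log x :=
    primeCounting_isEquivalent_holds
  -- `π log x - θ ∼ x / log x`
  have hA : (fun x : ℝ ↦ (Nat.primeCounting ⌊x⌋₊ : ℝ) * Real.log x - θ x) ~[atTop]
      fun x ↦ x / Real.log x := by
    have h1 : (fun x : ℝ ↦ Real.log x * ∫ t in (2 : ℝ)..x, θ t / (t * Real.log t ^ 2)) ~[atTop]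
        fun x ↦ Real.log x * (x / Real.log x ^ 2) :=
      IsEquivalent.mul IsEquivalent.refl isEquivalent_integral_theta_div
    have h2 : (fun x : ℝ ↦ Real.log x * (x / Real.log x ^ 2)) =ᶠ[atTop] fun x ↦ x / Real.log x := by
      filter_upwards [eventually_gt_atTop 1] with x hx
      have : Real.log x ≠ 0 := (Real.log_pos hx).ne'
      field_simp
    have h3 : (fun x : ℝ ↦ Real.log x * ∫ t in (2 : ℝ)..x, θ t / (t * Real.log t ^ 2))
        =ᶠ[atTop] fun x : ℝ ↦ (Nat.primeCounting ⌊x⌋₊ : ℝ) * Real.log x - θ x := by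
      filter_upwards [eventually_ge_atTop 2] with x hx
      have hlog : Real.log x ≠ 0 := (Real.log_pos (by linarith)).ne'
      rw [Chebyshev.primeCounting_eq_theta_div_log_add_integral hx]
      field_simp
      ring
    exact (h1.congr_left h3).congr_right h2
  have hA' : (fun x : ℝ ↦ (Nat.primeCounting ⌊x⌋₊ : ℝ) * Real.log x - θ x) ~[atTop]
      fun x ↦ (Nat.primeCounting ⌊x⌋₊ : ℝ) := hA.trans hπ.symm
  have hne : ∀ᶠ x : ℝ in atTop, (Nat.primeCounting ⌊x⌋₊ : ℝ) ≠ 0 := by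
    filter_upwards [eventually_ge_atTop 2] with x hx
    have h2 : 2 ≤ ⌊x⌋₊ := Nat.le_floor hx
    have : 0 < Nat.primeCounting ⌊x⌋₊ := by
      have := Nat.monotone_primeCounting h2
      have h22 : Nat.primeCounting 2 = 1 := by decide
      omega
    exact_mod_cast this.ne'
  exact (isEquivalent_iff_tendsto_one hne).mp hA'

/-- **`π(x) log x / x → 1`** (the prime number theorem). [cite: MontgomeryVaughan2007, §8.1 eq. (8.1)] -/
theorem tendsto_primeCounting_mul_log_div :
    Tendsto (fun x : ℝ ↦ (Nat.primeCounting ⌊x⌋₊ : ℝ) * Real.log x / x) atTop (𝓝 1) := by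
  have hπ : (fun x : ℝ ↦ (Nat.primeCounting ⌊x⌋₊ : ℝ)) ~[atTop] fun x ↦ x / Real.log x :=
    primeCounting_isEquivalent_holds
  have hne : ∀ᶠ x : ℝ in atTop, x / Real.log x ≠ 0 := by
    filter_upwards [eventually_gt_atTop 1] with x hx
    exact div_ne_zero (by linarith) (Real.log_pos hx).ne'
  have h := (isEquivalent_iff_tendsto_one hne).mp hπ
  refine h.congr' ?_
  filter_upwards [eventually_gt_atTop 1] with x hx
  have hlog : Real.log x ≠ 0 := (Real.log_pos hx).ne'
  have hx0 : x ≠ 0 := by linarith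
  simp only [Pi.div_apply]
  field_simp

/-! ### Along the sequence of primes -/

/-- `π(p_n) = n + 1` for the `n`-th prime `p_n` (`p_0 = 2`). [folklore] -/
theorem primeCounting_nth_prime (n : ℕ) : Nat.primeCounting (Nat.nth Nat.Prime n) = n + 1 := by
  have h1 : Nat.primeCounting (Nat.nth Nat.Prime n)
      = Nat.count Nat.Prime (Nat.nth Nat.Prime n + 1) := rfl
  rw [h1, Nat.count_succ, Nat.count_nth_of_infinite Nat.infinite_setOf_prime]
  simp [Nat.prime_nth_prime n]

/-- The primes up to `p_n` are `p_0, …, p_n`. [folklore] -/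
theorem primesLE_nth_prime (n : ℕ) :
    Nat.primesLE (Nat.nth Nat.Prime n) = (Finset.range (n + 1)).image (Nat.nth Nat.Prime) := by
  ext p
  rw [Nat.mem_primesLE, Finset.mem_image]
  constructor
  · rintro ⟨hle, hp⟩
    refine ⟨Nat.count Nat.Prime p, ?_, Nat.nth_count hp⟩
    rw [Finset.mem_range, Nat.lt_succ_iff]
    exact (Nat.count_monotone Nat.Prime hle).trans_eq
      (Nat.count_nth_of_infinite Nat.infinite_setOf_prime n)
  · rintro ⟨k, hk, rfl⟩
    rw [Finset.mem_range, Nat.lt_succ_iff] at hk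
    exact ⟨(Nat.nth_monotone Nat.infinite_setOf_prime) hk, Nat.prime_nth_prime k⟩

/-- `θ(p_n) = ∑_{k ≤ n} log p_k`. [folklore] -/
theorem theta_nth_prime (n : ℕ) :
    θ (Nat.nth Nat.Prime n) = ∑ k ∈ Finset.range (n + 1), Real.log (Nat.nth Nat.Prime k) := by
  rw [Chebyshev.theta_eq_sum_primesLE_log, primesLE_nth_prime, Finset.sum_image]
  intro a _ b _ h
  exact (Nat.nth_strictMono Nat.infinite_setOf_prime).injective h

/-- `p_n → ∞`. [folklore] -/
theorem tendsto_nth_prime_atTop :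
    Tendsto (fun n ↦ ((Nat.nth Nat.Prime n : ℕ) : ℝ)) atTop atTop :=
  tendsto_natCast_atTop_atTop.comp (Nat.nth_strictMono Nat.infinite_setOf_prime).tendsto_atTop

/-- **`(n + 1) log p_n / p_n → 1`** (prime number theorem along the primes).
[cite: MontgomeryVaughan2007, §8.1 eq. (8.1)] -/
theorem tendsto_card_mul_log_nth_prime_div :
    Tendsto (fun n : ℕ ↦ ((n + 1 : ℕ) : ℝ) * Real.log (Nat.nth Nat.Prime n)
      / (Nat.nth Nat.Prime n : ℝ)) atTop (𝓝 1) := by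
  have h := tendsto_primeCounting_mul_log_div.comp tendsto_nth_prime_atTop
  refine h.congr ?_
  intro n
  simp only [Function.comp_apply, Nat.floor_natCast, primeCounting_nth_prime]

/-- **`(∑_{1 ≤ k ≤ n} log p_k)/(n + 1) - log p_n → -1`**: the mean of `log p` over the odd
primes up to `p_n`, normalised by `π(p_n) = n + 1`, is `log p_n - 1 + o(1)` (Bright 2024 uses the
finer Lemma 2.8 there; this leading-order form follows from `θ(x)/π(x) = log x - 1 + o(1)` and
`log 2/(n+1) → 0`). [cite: Bright2024, Lemma 2.8] -/
theorem tendsto_sum_log_nth_prime_div_sub_log :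
    Tendsto (fun n : ℕ ↦ (∑ i : Fin n, Real.log (Nat.nth Nat.Prime (i + 1))) / ((n + 1 : ℕ) : ℝ)
      - Real.log (Nat.nth Nat.Prime n)) atTop (𝓝 (-1)) := by
  -- `θ(p_n)/(n+1) - log p_n → -1`
  have h1 : Tendsto (fun n : ℕ ↦ θ (Nat.nth Nat.Prime n) / ((n + 1 : ℕ) : ℝ)
      - Real.log (Nat.nth Nat.Prime n)) atTop (𝓝 (-1)) := by
    have h := tendsto_primeCounting_mul_log_sub_theta_div.comp tendsto_nth_prime_atTop
    refine Tendsto.congr (fun n => ?_) h.neg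
    simp only [Function.comp_apply, Nat.floor_natCast, primeCounting_nth_prime]
    have : ((n + 1 : ℕ) : ℝ) ≠ 0 := by positivity
    field_simp
    ring
  -- `log 2 / (n+1) → 0`
  have h2 : Tendsto (fun n : ℕ ↦ Real.log 2 / ((n + 1 : ℕ) : ℝ)) atTop (𝓝 0) := by
    have : Tendsto (fun n : ℕ ↦ ((n + 1 : ℕ) : ℝ)) atTop atTop :=
      tendsto_natCast_atTop_atTop.comp (tendsto_add_atTop_nat 1)
    exact tendsto_const_nhds.div_atTop this
  have h3 := h1.sub h2
  rw [sub_zero] at h3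
  refine h3.congr ?_
  intro n
  have hθ : θ (Nat.nth Nat.Prime n)
      = (∑ i : Fin n, Real.log (Nat.nth Nat.Prime (i + 1))) + Real.log 2 := by
    rw [theta_nth_prime, Finset.sum_range_succ', Nat.nth_prime_zero_eq_two,
      ← Fin.sum_univ_eq_sum_range]
    push_cast
    rfl
  rw [hθ]
  ring

end Literature.NumberTheory.LFunctions

end
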